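import Mathlib
import HarnessLib
import Literature.MathematicalPhysics.StatisticalMechanics.MuGSC
import Literature.MathematicalPhysics.StatisticalMechanics.LennardJonesClusters
import Summits.AtomisticToContinuum.Crystallization.Theses.OverbindingBudget
import Summits.AtomisticToContinuum.Crystallization.Theorems.OverbindingBudgetCubeChargeLaw
import Summits.AtomisticToContinuum.Crystallization.Theorems.OverbindingBudgetPatchContinuity

/-!
# OverbindingBudget — the crux `BindingSignLaw` (stmt-29085) PROVED

`theorem bindingSignLaw : …Theses.OverbindingBudget.BindingSignLaw`.  Mechanism (the route docstring's plan,
made quantitative): if some site `y₀` of a recurrent, relatively dense μGSC `Y` had binding charge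
`φ_Y(y₀) − 2e = δ ≠ 0` while all charges have one sign, then PATCH CONTINUITY
(`OverbindingBudgetPatchContinuity.field_patch_continuity`) and RECURRENCE put a site of charge `≥ |δ|/2` (same
sign) inside every sub-cube of side `2L + 2`; a grid of `n³` such sub-cubes gives `|Σ_(Y∩Q) (φ_Y − 2e)| ≥ n³|δ|/2`
on the cube `Q` of side `n(2L+2)`, contradicting the CUBE CHARGE LAW `|Σ_(Y∩Q)(φ_Y − 2e)| ≤ η ℓ³`
(`OverbindingBudgetCubeChargeLaw.cubeChargeLaw`, η := |δ|/(4(2L+2)³)).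
-/

namespace Summit.AtomisticToContinuum.Crystallization.Theorems.OverbindingBudgetBindingSignLaw

open Literature.MathematicalPhysics.StatisticalMechanics
open Summit.AtomisticToContinuum.Crystallization.Theorems.OverbindingBudgetCubeChargeLaw (cubeChargeLaw)
open Summit.AtomisticToContinuum.Crystallization.Theorems.OverbindingBudgetPatchContinuity
  (field_patch_continuity)

/-- Grid lower bound: if `g ≥ 0` on `Y` and every ball of radius `s/2` contains a site of `Y` with `g ≥ a`,
then on the half-open cube of side `n·s` the sum of `g` over `Y` is at least `n³ a`. [folklore] -/
theorem grid_lower_bound {Y : Set (EuclideanSpace ℝ (Fin 3))} (g : EuclideanSpace ℝ (Fin 3) → ℝ) (hg : ∀ y ∈ Y, 0 ≤ g y)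
    {a s : ℝ} (hs : 0 < s) (hheavy : ∀ z : EuclideanSpace ℝ (Fin 3), ∃ q ∈ Y, dist q z < s / 2 ∧ a ≤ g q) (n : ℕ)
    (c : EuclideanSpace ℝ (Fin 3)) (F : Finset (EuclideanSpace ℝ (Fin 3)))
    (hF : (↑F : Set (EuclideanSpace ℝ (Fin 3))) = Y ∩ {z | ∀ i : Fin 3, c i ≤ z i ∧ z i < c i + n * s}) :
    (n : ℝ) ^ 3 * a ≤ ∑ y ∈ F, g y := by
  classical
  choose q hqY hqd hqa using hheavy
  obtain ⟨pt, hpt⟩ : ∃ pt : (Fin 3 → Fin n) → EuclideanSpace ℝ (Fin 3),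
      ∀ v, pt v = q (c + WithLp.toLp 2 (fun j => s * (((v j : ℕ) : ℝ) + 1 / 2))) := ⟨_, fun _ => rfl⟩
  have hptY : ∀ v, pt v ∈ Y := fun v => by rw [hpt]; exact hqY _
  have hpta : ∀ v, a ≤ g (pt v) := fun v => by rw [hpt]; exact hqa _
  have hcoord : ∀ (v : Fin 3 → Fin n) (i : Fin 3),
      c i + s * ((v i : ℕ) : ℝ) < pt v i ∧ pt v i < c i + s * (((v i : ℕ) : ℝ) + 1) := by
    intro v i
    set z : EuclideanSpace ℝ (Fin 3) := c + WithLp.toLp 2 (fun j => s * (((v j : ℕ) : ℝ) + 1 / 2)) with hz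
    have hzi : z i = c i + s * (((v i : ℕ) : ℝ) + 1 / 2) := by simp [hz]
    have hd : dist (q z) z < s / 2 := hqd z
    have hi : |q z i - z i| < s / 2 :=
      lt_of_le_of_lt (le_of_eq_of_le (Real.dist_eq (q z i) (z i)).symm (PiLp.dist_apply_le (q z) z i)) hd
    rw [hpt v, ← hz]
    rw [hzi] at hi
    exact ⟨by linarith [(abs_lt.1 hi).1], by linarith [(abs_lt.1 hi).2]⟩
  have hmem : ∀ v, pt v ∈ F := by
    intro v
    rw [← Finset.mem_coe, hF]
    refine ⟨hptY v, fun i => ⟨?_, ?_⟩⟩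
    · have h := (hcoord v i).1
      have : 0 ≤ s * ((v i : ℕ) : ℝ) := by positivity
      linarith
    · have h := (hcoord v i).2
      have hvn : ((v i : ℕ) : ℝ) + 1 ≤ n := by exact_mod_cast Nat.succ_le_of_lt (v i).isLt
      nlinarith
  have hinj : Function.Injective pt := by
    intro u v huv
    funext i
    have h1 := hcoord u i
    have h2 := hcoord v i
    rw [huv] at h1
    have hu : s * ((u i : ℕ) : ℝ) < s * (((v i : ℕ) : ℝ) + 1) := by linarith [h1.1, h2.2]
    have hv : s * ((v i : ℕ) : ℝ) < s * (((u i : ℕ) : ℝ) + 1) := by linarith [h2.1, h1.2]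
    have hu' : ((u i : ℕ) : ℝ) < ((v i : ℕ) : ℝ) + 1 := lt_of_mul_lt_mul_left hu hs.le
    have hv' : ((v i : ℕ) : ℝ) < ((u i : ℕ) : ℝ) + 1 := lt_of_mul_lt_mul_left hv hs.le
    have hu'' : (u i : ℕ) < (v i : ℕ) + 1 := by exact_mod_cast hu'
    have hv'' : (v i : ℕ) < (u i : ℕ) + 1 := by exact_mod_cast hv'
    exact Fin.ext (by omega)
  have himg : Finset.univ.image pt ⊆ F := by
    intro y hy
    obtain ⟨v, -, rfl⟩ := Finset.mem_image.1 hy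
    exact hmem v
  have hFY : ∀ y ∈ F, y ∈ Y := fun y hy => by
    have h : y ∈ (↑F : Set (EuclideanSpace ℝ (Fin 3))) := Finset.mem_coe.2 hy
    rw [hF] at h
    exact h.1
  have hcard : Fintype.card (Fin 3 → Fin n) = n ^ 3 := by simp
  have hconst : ∑ _v : Fin 3 → Fin n, a = (n : ℝ) ^ 3 * a := by
    rw [Finset.sum_const, Finset.card_univ, hcard, nsmul_eq_mul]; push_cast; ring
  calc (n : ℝ) ^ 3 * a = ∑ _v : Fin 3 → Fin n, a := hconst.symm
    _ ≤ ∑ v : Fin 3 → Fin n, g (pt v) := Finset.sum_le_sum fun v _ => hpta v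
    _ = ∑ y ∈ Finset.univ.image pt, g y := (Finset.sum_image fun u _ v _ h => hinj h).symm
    _ ≤ ∑ y ∈ F, g y := Finset.sum_le_sum_of_subset_of_nonneg himg fun y hy _ => hg y (hFY y hy)

set_option maxHeartbeats 800000 in
/-- **The crux `BindingSignLaw`.** Under the route's standing hypotheses (recurrent, uniformly discrete,
relatively dense μGSC `Y` of the Lennard-Jones energy `e`), one-signed binding charge forces zero charge:
`φ_Y ≡ 2e`. [cite: Suto2006, Theorem 2; this file] -/
theorem bindingSignLaw :
    Summit.AtomisticToContinuum.Crystallization.Theses.OverbindingBudget.BindingSignLaw := by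
  intro e hlb Y hrec hUD hμ hdense hsign y₀ hy₀
  classical
  by_contra hne
  have ha0 : 0 < |(∑' w : ↥Y, lennardJones (dist y₀ (w : EuclideanSpace ℝ (Fin 3)))) - 2 * e| :=
    abs_pos.2 (sub_ne_zero.2 hne)
  set a : ℝ := |(∑' w : ↥Y, lennardJones (dist y₀ (w : EuclideanSpace ℝ (Fin 3)))) - 2 * e| with ha
  obtain ⟨R, ε, hε, hpc⟩ := field_patch_continuity hUD (half_pos ha0)
  obtain ⟨L, hL⟩ := hrec R ε hε
  have hL0 : 0 ≤ L := by
    obtain ⟨q', -, hq'd, -, -⟩ := hL y₀ hy₀ y₀ hy₀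
    exact dist_nonneg.trans hq'd
  set s : ℝ := 2 * L + 2 with hs
  have hs0 : 0 < s := by linarith
  have hη : 0 < a / (4 * s ^ 3) := by positivity
  obtain ⟨ℓ₀, hℓ₀⟩ := cubeChargeLaw e hlb Y hUD hμ (a / (4 * s ^ 3)) hη
  set n : ℕ := ⌈ℓ₀ / s⌉₊ + 1 with hn
  have hn1 : (1 : ℝ) ≤ n := by rw [hn]; exact_mod_cast Nat.le_add_left 1 _
  have hℓ : ℓ₀ ≤ (n : ℝ) * s := by
    have h1 : ℓ₀ / s ≤ ⌈ℓ₀ / s⌉₊ := Nat.le_ceil _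
    have h2 : (n : ℝ) = (⌈ℓ₀ / s⌉₊ : ℝ) + 1 := by rw [hn]; push_cast; ring
    have h4 : ℓ₀ / s * s ≤ (⌈ℓ₀ / s⌉₊ : ℝ) * s := mul_le_mul_of_nonneg_right h1 hs0.le
    rw [div_mul_cancel₀ ℓ₀ hs0.ne'] at h4
    rw [h2]; nlinarith
  have hns0 : 0 ≤ (n : ℝ) * s := by positivity
  have hfin : (Y ∩ {z | ∀ i : Fin 3, (0 : EuclideanSpace ℝ (Fin 3)) i ≤ z i ∧ z i < (0 : EuclideanSpace ℝ (Fin 3)) i + n * s}).Finite := by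
    -- the half-open cube of side `n s` at the origin lies in the closed ball of radius `3 n s`
    refine (hUD.finite_inter_closedBall 0 (3 * (n * s))).subset ?_
    rintro z ⟨hzY, hz⟩
    refine ⟨hzY, ?_⟩
    rw [Metric.mem_closedBall, EuclideanSpace.dist_eq]
    have hi : ∀ i, dist (z i) ((0 : EuclideanSpace ℝ (Fin 3)) i) ^ 2 ≤ ((n : ℝ) * s) ^ 2 := by
      intro i
      rw [Real.dist_eq]
      have h := hz i
      have habs : |z i - (0 : EuclideanSpace ℝ (Fin 3)) i| ≤ n * s := by
        rw [abs_le]; constructor <;> linarith [h.1, h.2]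
      nlinarith [abs_nonneg (z i - (0 : EuclideanSpace ℝ (Fin 3)) i)]
    calc √(∑ i, dist (z i) ((0 : EuclideanSpace ℝ (Fin 3)) i) ^ 2) ≤ √(∑ _i : Fin 3, ((n : ℝ) * s) ^ 2) :=
          Real.sqrt_le_sqrt (Finset.sum_le_sum (fun i _ => hi i))
      _ = √(3 * ((n : ℝ) * s) ^ 2) := by simp
      _ ≤ √((3 * ((n : ℝ) * s)) ^ 2) := Real.sqrt_le_sqrt (by nlinarith)
      _ = 3 * ((n : ℝ) * s) := Real.sqrt_sq (by positivity)
  obtain ⟨F, hF⟩ : ∃ F : Finset (EuclideanSpace ℝ (Fin 3)), (↑F : Set (EuclideanSpace ℝ (Fin 3))) =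
      Y ∩ {z | ∀ i : Fin 3, (0 : EuclideanSpace ℝ (Fin 3)) i ≤ z i ∧ z i < (0 : EuclideanSpace ℝ (Fin 3)) i + n * s} :=
    ⟨hfin.toFinset, Set.Finite.coe_toFinset _⟩
  have hcl := hℓ₀ ((n : ℝ) * s) 0 hℓ F hF
  have hηℓ : a / (4 * s ^ 3) * ((n : ℝ) * s) ^ 3 = (n : ℝ) ^ 3 * a / 4 := by
    field_simp
  rw [hηℓ] at hcl
  -- a heavy site of the same sign inside every ball of radius s/2
  have hheavy : ∀ z : EuclideanSpace ℝ (Fin 3), ∃ q' ∈ Y, dist q' z < s / 2 ∧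
      |(∑' w : ↥Y, lennardJones (dist q' (w : EuclideanSpace ℝ (Fin 3)))) -
        (∑' w : ↥Y, lennardJones (dist y₀ (w : EuclideanSpace ℝ (Fin 3))))| ≤ a / 2 := by
    intro z
    obtain ⟨w, hwY, hwz⟩ := hdense z
    obtain ⟨q', hq'Y, hq'd, hfwd, hbwd⟩ := hL y₀ hy₀ w hwY
    refine ⟨q', hq'Y, ?_, hpc y₀ hy₀ q' hq'Y hfwd hbwd⟩
    calc dist q' z ≤ dist q' w + dist w z := dist_triangle _ _ _
      _ < s / 2 := by rw [dist_comm w z, hs]; linarith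
  have hna : a ≤ (n : ℝ) ^ 3 * a := le_mul_of_one_le_left ha0.le (one_le_pow₀ hn1)
  rcases hsign with hpos | hneg
  · -- all charges are nonnegative
    have hd : (∑' w : ↥Y, lennardJones (dist y₀ (w : EuclideanSpace ℝ (Fin 3)))) - 2 * e = a := by
      rw [ha, abs_of_nonneg (by linarith [hpos y₀ hy₀])]
    obtain ⟨g, hg⟩ : ∃ g : EuclideanSpace ℝ (Fin 3) → ℝ,
        ∀ y, g y = (∑' w : ↥Y, lennardJones (dist y (w : EuclideanSpace ℝ (Fin 3)))) - 2 * e := ⟨_, fun _ => rfl⟩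
    have hgn : ∀ y ∈ Y, 0 ≤ g y := fun y hy => by rw [hg]; linarith [hpos y hy]
    have hgh : ∀ z : EuclideanSpace ℝ (Fin 3), ∃ q ∈ Y, dist q z < s / 2 ∧ a / 2 ≤ g q := by
      intro z
      obtain ⟨q', hq'Y, hq'd, hq'c⟩ := hheavy z
      refine ⟨q', hq'Y, hq'd, ?_⟩
      rw [hg]
      have := (abs_le.1 hq'c).1
      linarith
    have hgrid := grid_lower_bound g hgn hs0 hgh n 0 F hF
    have hsum : ∑ y ∈ F, g y = ∑ y ∈ F, ((∑' w : ↥Y, lennardJones (dist y (w : EuclideanSpace ℝ (Fin 3)))) - 2 * e) :=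
      Finset.sum_congr rfl fun y _ => hg y
    rw [hsum] at hgrid
    have := le_abs_self (∑ y ∈ F, ((∑' w : ↥Y, lennardJones (dist y (w : EuclideanSpace ℝ (Fin 3)))) - 2 * e))
    linarith
  · -- all charges are nonpositive
    have hd : (∑' w : ↥Y, lennardJones (dist y₀ (w : EuclideanSpace ℝ (Fin 3)))) - 2 * e = -a := by
      rw [ha, abs_of_nonpos (by linarith [hneg y₀ hy₀])]; ring
    obtain ⟨g, hg⟩ : ∃ g : EuclideanSpace ℝ (Fin 3) → ℝ,
        ∀ y, g y = 2 * e - ∑' w : ↥Y, lennardJones (dist y (w : EuclideanSpace ℝ (Fin 3))) := ⟨_, fun _ => rfl⟩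
    have hgn : ∀ y ∈ Y, 0 ≤ g y := fun y hy => by rw [hg]; linarith [hneg y hy]
    have hgh : ∀ z : EuclideanSpace ℝ (Fin 3), ∃ q ∈ Y, dist q z < s / 2 ∧ a / 2 ≤ g q := by
      intro z
      obtain ⟨q', hq'Y, hq'd, hq'c⟩ := hheavy z
      refine ⟨q', hq'Y, hq'd, ?_⟩
      rw [hg]
      have := (abs_le.1 hq'c).2
      linarith
    have hgrid := grid_lower_bound g hgn hs0 hgh n 0 F hF
    have hsum : ∑ y ∈ F, g y = -∑ y ∈ F, ((∑' w : ↥Y, lennardJones (dist y (w : EuclideanSpace ℝ (Fin 3)))) - 2 * e) := by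
      rw [← Finset.sum_neg_distrib]
      exact Finset.sum_congr rfl fun y _ => by rw [hg]; ring
    rw [hsum] at hgrid
    have := neg_le_abs (∑ y ∈ F, ((∑' w : ↥Y, lennardJones (dist y (w : EuclideanSpace ℝ (Fin 3)))) - 2 * e))
    linarith

end Summit.AtomisticToContinuum.Crystallization.Theorems.OverbindingBudgetBindingSignLaw
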